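import Summits.CriticalPhenomena.PercolationContinuityZ3.Theorems.Transplant.SkelConcChoice
import Summits.CriticalPhenomena.PercolationContinuityZ3.Theorems.Transplant.SkelConcSchedule
import Summits.CriticalPhenomena.PercolationContinuityZ3.Theorems.Transplant.SkelConcExcessRadius
import Summits.CriticalPhenomena.PercolationContinuityZ3.Theorems.Transplant.SkelConcParamsKit
import Summits.CriticalPhenomena.PercolationContinuityZ3.Theorems.Transplant.SkelFatRadius
import Summits.CriticalPhenomena.PercolationContinuityZ3.Theorems.Transplant.SkelCylRadFrame
import Summits.CriticalPhenomena.PercolationContinuityZ3.Theorems.Transplant.BoxProdZ2ConcParams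
import HarnessLib

/-!
# L7.5: THE CONCRETE GENERIC CHOICES `SkelConc.concChoice₀ : ChoiceFn` of design (D) over a `PlanarSkeletonConc` — the product's
# `BoxProdZ2.concChoice₀` (p226064) under the dictionary of CONC-PARAMS-GENERIC.md §1 with the constants of §5 (D1–D12), fixed against the
# posted hypothesis lists of the three generic residue theorems ((R) p2-g4 20:44/21:45Z = binders of `Skel.rootOblA_concSG_raw`; (F) hp-8 g24
# 20:51/20:57Z = binders of `Skel.faceOblR_concS` + block (B) v1; (C) p5-g4 21:23/21:39Z final; kit constants p3-g4 20:47Z / p1-g7 21:44Z):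
# `ψ := Skel.fatRadius Φ hC` (centre-free), base vertices `Φ.types`, schedule `Skel.concRadiiS` (p2-g3 L3.3), excess radius
# `SkelConc.excessRadiusAtK` (centre-free) at planar diameter `60 r`, `dG := 100 r` in the excess slot of `gapFn`, the seed-slab-v3 kit constants
# (`T₀ = 3M+4`, `cU = (Δ+1)^{ψ M}`, `R′_seed = max (cylRadMax (M+1) (7M+13)) (cylRadMax (M+1) (2M+3+ψ M))`, `cS = (Δ+1)^{R′_seed} + T₀ + 2`,
# `sB = 1 + Δ cS + cS cU`, `rs = max (7M+12+R′_seed) (6M+9+ψ M)`, `B = (Δ+1)^{2 rs}`, `r₀ = max (4M+6+R′_seed) (6M+8+ψ M)`, kit reach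
# `rs + R′_seed + 9M + 13 + ψ M`), `R' := L + 8 M + 13`, scales `Icc M (6t)`, the inner radius `L_A := 24 r + 2(ψ(6t) + ψ M) + Rex q (2 ψ M) + dL`
# (`dL := 24 t + 8 M + 12`; planar travel is paid in the graph radius), the collar `L' := L_A + ψ(6t) + ψ M + 12 t + 2 M + reach`, the root seed
# radius `E₀ := L' + 45 r + ψ M` (column room `E₀ ≥ 44 r + 4`), `gap := gapFn L' (Rex q · + 100 r)`, `Λ := Skel.concRadiiS C gap 0 E₀ L'` — plus
# `wfHoldsFn_concChoice₀` (`Skel.concRadiiS_WFS` + `K₀ ≤ K`). The unpacking lemmas are `SkelConcParamsAtQ/Root/Face`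

builds on p205010 (kernel theorem, internal audit signed; external expert review pending) — nothing in this file uses p205010.
Status sentence (coordinator 2026-08-20T04:30Z): "θ(p_c) = 0 on ℤ^d, all d ≥ 2 — kernel-verified (Lean 4/Mathlib, standard axioms); internal adversarial
audit SIGNED 2026-08-20 04:29Z; external expert review pending."
Lane `prim-bschramm-*`, seat `prim-bschramm-stmt` (gen 7); helper file (`--supports stmt-CriticalPhenomena-4575`).
Parameter ledger: `run/shared/lean/prim/bschramm/prim-bschramm-stmt/CONC-PARAMS-GENERIC.md`.
[cite: KozmaNitzan2024, §4 Theorem 6 (pp. 25–31): the order of constants; Lemma 10 Steps II–III (pp. 18–19); Lemma 12 (p. 24)]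
-/

noncomputable section

open MeasureTheory
open scoped Classical

namespace Summit.CriticalPhenomena.PercolationContinuityZ3.Theorems

namespace Transplant

namespace SkelConc

open Literature.Probability.Percolation Literature.Probability.LatticeModels SimpleGraph KNCells KNLevels
open BoxProdZ2 (ConcRadiiG ConcConsts δmin δmin_sq_pos kitK kitN kitL cellsOf tOf Kof gapFn K₀_le_cellsOf_K one_le_gapFn le_of_mem_Icc_scales)

/-! ## §0 The generic constants as the product's `ConcConsts` (for `δmin` and its lemmas) -/

/-- The product's constants record from the generic one and a degree (only `δmin κ nR δA` and its lemmas read it). [this work] -/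
def Consts.prod (κ : Consts) (Δ : ℕ) : ConcConsts := ⟨Δ, κ.K₀, κ.δ, κ.δ₂, κ.δr, κ.hδ0, κ.hδ1, κ.hδ₂0, κ.hδ₂1, κ.hδr⟩

/-- `(κ.prod Δ).K₀ = κ.K₀`. [folklore] -/
@[simp] theorem Consts.prod_K₀ (κ : Consts) (Δ : ℕ) : (κ.prod Δ).K₀ = κ.K₀ := rfl

/-! ## §1 The concrete choices at a centred `(κ, Φ, t, p, hC)` -/

namespace Conc

section Defs

variable (κ : Consts) {V : Type} [DecidableEq V] [Countable V] {G : SimpleGraph V} [G.LocallyFinite] (Φ : PlanarSkeletonConc G)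
  (p : unitInterval) (hC : Φ.toPlanarSkeleton.CylSubcritical p) (δA : ℝ)

/-- The root-chain length index: the root run has `44` advances (as in the product). [this work] -/
def nR : ℕ := 44

/-- The fat radius at `p` (centre-free: the same at every base vertex and, by frames, at every centre). [folklore] -/
abbrev ψ (n : ℕ) : ℕ := Skel.fatRadius Φ hC n

/-! #### Seed-slab-v3 kit constants (closed forms; CONC-PARAMS-GENERIC (D11)) -/

/-- The tangential clamp offset `T₀ := 3 M + 4` (`= 2 ℓ_s + 2 + M`, `ℓ_s = M + 1`). [this work] -/
def T₀c (M : ℕ) : ℕ := 3 * M + 4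

/-- The face-count bound `cU := (Δ+1)^{ψ M}`. [this work] -/
def cUc (M : ℕ) : ℕ := (Φ.Δ + 1) ^ ψ Φ p hC M

/-- The seed-slab radius `R′_seed := max (cylRadMax (M+1) (7M+13)) (cylRadMax (M+1) (2M+3+ψ M))` (type-uniform comparison radius). [this work] -/
def Rseedc (M : ℕ) : ℕ := max (Φ.cylRadMax (M + 1) (7 * M + 13)) (Φ.cylRadMax (M + 1) (2 * M + 3 + ψ Φ p hC M))

/-- The seed-region size bound `cS := (Δ+1)^{R′_seed} + T₀ + 2`. [this work] -/
def cSc (M : ℕ) : ℕ := (Φ.Δ + 1) ^ Rseedc Φ p hC M + (T₀c M + 2)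

/-- The seed size bound `sB := 1 + Δ cS + cS cU` (Step III). [this work] -/
def sBc (M : ℕ) : ℕ := 1 + Φ.Δ * cSc Φ p hC M + cSc Φ p hC M * cUc Φ p hC M

/-- The apartness radius `rs := max (7M + 12 + R′_seed) (6M + 9 + ψ M)`. [this work] -/
def rsc (M : ℕ) : ℕ := max (7 * M + 12 + Rseedc Φ p hC M) (6 * M + 9 + ψ Φ p hC M)

/-- The contact multiplier `B := (Δ+1)^{2 rs}` (`N = k · B`). [this work] -/
def Bc (M : ℕ) : ℕ := (Φ.Δ + 1) ^ (2 * rsc Φ p hC M)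

/-- The near/far threshold `r₀ := max (4M + 6 + R′_seed) (6M + 8 + ψ M)` (p1-g7's `hr₀₁/hr₀₂` at `ℓ_s = M + 1`). [this work] -/
def r₀c (M : ℕ) : ℕ := max (4 * M + 6 + Rseedc Φ p hC M) (6 * M + 8 + ψ Φ p hC M)

/-- A kit-reach allowance `rs + R′_seed + 9 M + 13 + ψ M` (every seed slab / cube / face of a contact lies within this graph distance of the
contact; a generous bound, enters `L'` only). [this work] -/
def reachK (M : ℕ) : ℕ := rsc Φ p hC M + Rseedc Φ p hC M + 9 * M + 13 + ψ Φ p hC M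

/-! #### Counts, planar constants, scales -/

/-- The number of seeds `k` (at accuracy `δmin`, kit scale `M`). [folklore] -/
def kc (M : ℕ) : ℕ := kitK Φ.Δ (sBc Φ p hC M) (Bc Φ p hC M) (δmin (κ.prod Φ.Δ) nR δA) p

/-- The number of contacts `N`. [folklore] -/
def Nc (M : ℕ) : ℕ := kitN Φ.Δ (sBc Φ p hC M) (Bc Φ p hC M) (δmin (κ.prod Φ.Δ) nR δA) p

/-- The number of levels `L`. [folklore] -/
def Lc (M : ℕ) : ℕ := kitL Φ.Δ (sBc Φ p hC M) (Bc Φ p hC M) (δmin (κ.prod Φ.Δ) nR δA) p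

/-- The neighbourhood radius `R' := L + 8 M + 13` (window of `L` levels + tangential margin `2 T₀ = 6 M + 8` + exit offset `2 M + 4` + 1; seed slab
v3). [this work] -/
def R'c (M : ℕ) : ℕ := Lc κ Φ p hC δA M + 8 * M + 13

/-- The planar cells `C := cellsOf K₀ R'`. [this work] -/
def Cc (M : ℕ) : PCells := cellsOf κ.K₀ (R'c κ Φ p hC δA M)

/-- The chain unit `t` (`r = 4 t`). [this work] -/
def tc (M : ℕ) : ℕ := tOf κ.K₀ (R'c κ Φ p hC δA M)

/-- The planar scales `S := Icc M (6 t)` (kit scale `M`, route / first-hop scales `M + 1, …, 6 t`). [this work] -/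
def Sc (M : ℕ) : Finset ℕ := Finset.Icc M (6 * tc κ Φ p hC δA M)

/-- The excess tolerance `η := δmin / 2`. [this work] -/
def ηc : ℝ := δmin (κ.prod Φ.Δ) nR δA / 2

/-- The excess radius at the running parameter (centre-free), planar diameter `60 r` (serves the root run's habitats of diameter `≤ 60 r` and the
faces' / corridors' `≤ 50 r`), entrance depth `ρ`. [this work] -/
def Rexc (M : ℕ) (q : unitInterval) (ρ : ℕ) : ℕ := excessRadiusAtK Φ (60 * (Cc κ Φ p hC δA M).r) (ηc κ Φ δA) q ρ

/-- The prism-scale / slab allowance `dL := 24 t + 8 M + 12`. [this work] -/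
def dL (M : ℕ) : ℕ := 24 * tc κ Φ p hC δA M + 8 * M + 12

/-- The inner radius of the face step's elongated routes: `L_A := 24 r + 2 (ψ (6t) + ψ M) + Rex q (2 ψ M) + dL` (the inner run's planar travel
`≤ 24 r` is paid in the graph radius; inner excess entrances at depth `2 ψ M`). [this work] -/
def LAc (M : ℕ) (q : unitInterval) : ℕ :=
  24 * (Cc κ Φ p hC δA M).r + 2 * (ψ Φ p hC (6 * tc κ Φ p hC δA M) + ψ Φ p hC M) + Rexc κ Φ p hC δA M q (2 * ψ Φ p hC M) + dL κ Φ p hC δA M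

/-- The collar width `L' := L_A + ψ (6 t) + ψ M + 12 t + 2 M + reachK M`. [this work] -/
def L'c (M : ℕ) (q : unitInterval) : ℕ :=
  LAc κ Φ p hC δA M q + ψ Φ p hC (6 * tc κ Φ p hC δA M) + ψ Φ p hC M + 12 * tc κ Φ p hC δA M + 2 * M + reachK Φ p hC M

/-- The root seed radius `E₀ := L' + 45 r + ψ M` (`dE`: the root corridor sets reach planar level `22 r`; column room `E₀ ≥ 44 r + 4`). [this work] -/
def E₀c (M : ℕ) (q : unitInterval) : ℕ := L'c κ Φ p hC δA M q + 45 * (Cc κ Φ p hC δA M).r + ψ Φ p hC M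

/-- The gap function `gap := gapFn L' (Rex q + 100 r)` (`dG`: planar travel per depth). [this work] -/
def gapc (M : ℕ) (q : unitInterval) : ℕ → ℕ :=
  gapFn (L'c κ Φ p hC δA M q) (fun n => Rexc κ Φ p hC δA M q n + 100 * (Cc κ Φ p hC δA M).r)

/-- The radius schedule `Λ := Skel.concRadiiS C gap 0 E₀ L'` (p2-g3's L3.3). [this work] -/
def Λc (M : ℕ) (q : unitInterval) : ConcRadiiG :=
  Skel.concRadiiS (Cc κ Φ p hC δA M) (gapc κ Φ p hC δA M q) (fun _ => 0) (E₀c κ Φ p hC δA M q) (L'c κ Φ p hC δA M q)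

end Defs

/-- **The concrete choices at a centred `(κ, Φ, t, p, hC)`** with inner accuracy `δA > 0`. [this work] -/
def choiceAt (κ : Consts) {V : Type} [DecidableEq V] [Countable V] {G : SimpleGraph V} [G.LocallyFinite] (Φ : PlanarSkeletonConc G)
    (t : V) (p : unitInterval) (hC : Φ.toPlanarSkeleton.CylSubcritical p) {δA : ℝ} (hδA : 0 < δA) : Choice κ Φ t p hC where
  δin := δmin (κ.prod Φ.Δ) nR δA ^ 2
  m₀ := 0
  S := fun _ M₀ => Sc κ Φ p hC δA M₀
  C := fun _ M₀ _ => Cc κ Φ p hC δA M₀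
  Λ := fun _ M₀ q => Λc κ Φ p hC δA M₀ q
  δin_pos := δmin_sq_pos (κ.prod Φ.Δ) nR hδA
  S_ge := fun _ _ _ _ hM => le_of_mem_Icc_scales hM

end Conc

/-! ## §2 The choice function and its well-formedness -/

/-- **THE CONCRETE GENERIC CHOICE FUNCTION** of design (D): `Conc.choiceAt` with the inner accuracy `δA Φ κ.K₀ κ.δ₂`.
[cite: KozmaNitzan2024, §4 Theorem 6 (pp. 25–31)] -/
def concChoice₀ : ChoiceFn :=
  fun κ _ _ _ _ _ Φ _ t _ _ p _ _ hC => Conc.choiceAt κ Φ t p hC (δA_pos Φ κ.K₀ κ.δ₂)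

/-- `concChoice₀` unfolds to `Conc.choiceAt` (by `rfl`). [folklore] -/
theorem concChoice₀_eq (κ : Consts) {V : Type} [DecidableEq V] [Countable V] (G : SimpleGraph V) [G.LocallyFinite]
    (Φ : PlanarSkeletonConc G) (hc : G.Connected) (t : V) (ht : t ∈ Φ.types) (h0 : Φ.φ t = 0) (p : unitInterval) (hp0 : 0 < (p : ℝ))
    (hp1 : (p : ℝ) < 1) (hC : Φ.toPlanarSkeleton.CylSubcritical p) :
    concChoice₀ κ G Φ hc t ht h0 p hp0 hp1 hC = Conc.choiceAt κ Φ t p hC (δA_pos Φ κ.K₀ κ.δ₂) := rfl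

/-- `2 ≤ E₀` (indeed `45 ≤ 45 r ≤ E₀`). [folklore] -/
theorem Conc.two_le_E₀c (κ : Consts) {V : Type} [DecidableEq V] [Countable V] {G : SimpleGraph V} [G.LocallyFinite] (Φ : PlanarSkeletonConc G)
    (p : unitInterval) (hC : Φ.toPlanarSkeleton.CylSubcritical p) (δA : ℝ) (M : ℕ) (q : unitInterval) :
    2 ≤ Conc.E₀c κ Φ p hC δA M q := by
  have hr := (Conc.Cc κ Φ p hC δA M).one_le_r
  unfold Conc.E₀c; omega

/-- `1 ≤ L'` (indeed `12 t ≤ L'`, `t ≥ 100`). [folklore] -/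
theorem Conc.one_le_L'c (κ : Consts) {V : Type} [DecidableEq V] [Countable V] {G : SimpleGraph V} [G.LocallyFinite] (Φ : PlanarSkeletonConc G)
    (p : unitInterval) (hC : Φ.toPlanarSkeleton.CylSubcritical p) (δA : ℝ) (M : ℕ) (q : unitInterval) :
    1 ≤ Conc.L'c κ Φ p hC δA M q := by
  have ht := BoxProdZ2.succ_le_tOf κ.K₀ (Conc.R'c κ Φ p hC δA M)
  unfold Conc.L'c Conc.tc; omega

/-- **The concrete choices are well formed**: `Skel.WFS C Λ` (`Skel.concRadiiS_WFS`: every gap `≥ 1`, `E₀ ≥ 2`, `L' ≥ 1`) and `K₀ ≤ C.K`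
(`K = max 20 K₀`). [this work] -/
theorem wfHoldsFn_concChoice₀ : WFHoldsFn concChoice₀ := by
  intro κ V _ _ G _ Φ hc t ht h0 p hp0 hp1 hC msel M₀ q _
  refine ⟨Skel.concRadiiS_WFS _ _ _ _ _ (fun n => one_le_gapFn _ _ n) (Conc.two_le_E₀c κ Φ p hC _ M₀ q)
    (Conc.one_le_L'c κ Φ p hC _ M₀ q), K₀_le_cellsOf_K _ _⟩

end SkelConc

end Transplant

end Summit.CriticalPhenomena.PercolationContinuityZ3.Theorems

end
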